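import Mathlib
import Summits.Ventures.PercRepro2.RBDefs
import Summits.Ventures.PercRepro2.RBRoot
import Summits.Ventures.PercRepro2.RBRootDefs
import Summits.Ventures.PercRepro2.RBRootEdge
import Summits.Ventures.PercRepro2.RBRootEdgePin
import Summits.Ventures.PercRepro2.RBRootEdgeMain
import Summits.Ventures.PercRepro2.RBRootEdgeT
import Summits.Ventures.PercRepro2.RBRootIsolated
import Summits.Ventures.PercRepro2.RBTwoMarkers
import Summits.Ventures.PercRepro2.RBTwoMarkersMain
import Summits.Ventures.PercRepro2.RBTwoMarkersCross
import Summits.Ventures.PercRepro2.RBTwoMarkersCrossMain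
import Summits.Ventures.PercRepro2.RBKernel
import Summits.Ventures.PercRepro2.RBParallel
import Summits.Ventures.PercRepro2.RBKernelDefs
import Summits.Ventures.PercRepro2.RBLeaf
import Summits.Ventures.PercRepro2.RBPruneDefs

/-!
# The typed kernel row with unmarked pendant neighbours (mine-a g5; MINE-A.md §25 + §33–§34)

`RB.RBcross_and_RBsame_of_pendant`: the typed row 2′RB holds at every vertex `w` each of whose
edges of nonzero weight goes to a root, a marker, or an unmarked pendant vertex (a vertex
`u ∉ {s, t, b, o, w}` whose only edge of nonzero weight is that edge). Proof: prune the pendant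
vertices one at a time (`RBLeaf.rbSum_prune_leaf`, the masses by `prob_leaf_update_events`;
induction on the number of edges of nonzero weight), then `RBcross_and_RBsame_of_nbhd'`.
`RB.RBcross_and_RBsame_of_prunable`: the same for every `p` that reduces to the kernel class by
any sequence of pendant prunings (`RB.Prunable`, RBPruneDefs.lean) — pendant unmarked trees of
any depth, anywhere in the graph.
-/

namespace Summit.Ventures.PercRepro2

namespace RB

open scoped Classical

variable {V : Type*} {E : Type*} [Fintype E] [DecidableEq E] [Fintype V] [DecidableEq V]
  {R : Type*} [Field R] [LinearOrder R] [IsStrictOrderedRing R]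

omit [DecidableEq V] in
/-- **The typed row at every vertex whose nonzero-weight edges go to roots, markers or unmarked
pendant vertices.** -/
theorem RBcross_and_RBsame_of_pendant {p : E → R} (hp : IsProbVec p) (ends : E → Sym2 V)
    (o b s t w : V)
    (H : ∀ e, w ∈ ends e → p e ≠ 0 →
      ends e = s(w, s) ∨ ends e = s(w, t) ∨ ends e = s(w, b) ∨ ends e = s(w, o) ∨
        ∃ u, ends e = s(w, u) ∧ u ≠ s ∧ u ≠ t ∧ u ≠ b ∧ u ≠ o ∧ u ≠ w ∧
          ∀ e', u ∈ ends e' → p e' ≠ 0 → e' = e) :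
    RBcross p ends o b s t w ∧ RBsame p ends o b s t w := by
  suffices key : ∀ n : ℕ, ∀ p : E → R, IsProbVec p →
      (∀ e, w ∈ ends e → p e ≠ 0 →
        ends e = s(w, s) ∨ ends e = s(w, t) ∨ ends e = s(w, b) ∨ ends e = s(w, o) ∨
          ∃ u, ends e = s(w, u) ∧ u ≠ s ∧ u ≠ t ∧ u ≠ b ∧ u ≠ o ∧ u ≠ w ∧
            ∀ e', u ∈ ends e' → p e' ≠ 0 → e' = e) →
      (Finset.univ.filter (fun e => p e ≠ 0)).card ≤ n →
      RBcross p ends o b s t w ∧ RBsame p ends o b s t w from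
    key _ p hp H le_rfl
  intro n
  induction n with
  | zero =>
    intro p hp _ hcard
    refine RBcross_and_RBsame_of_nbhd' hp ends o b s t w fun e _ hpe => ?_
    exfalso
    have : 0 < (Finset.univ.filter (fun e => p e ≠ 0)).card :=
      Finset.card_pos.2 ⟨e, Finset.mem_filter.2 ⟨Finset.mem_univ e, hpe⟩⟩
    omega
  | succ n ih =>
    intro p hp H hcard
    by_cases hpend : ∃ e, w ∈ ends e ∧ p e ≠ 0 ∧ ∃ u, ends e = s(w, u) ∧ u ≠ s ∧ u ≠ t ∧ u ≠ b ∧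
        u ≠ o ∧ u ≠ w ∧ ∀ e', u ∈ ends e' → p e' ≠ 0 → e' = e
    · obtain ⟨e, _, hpe, u, hends, hus, hut, hub, huo, huw, huniq⟩ := hpend
      have hp'v : IsProbVec (Function.update p e 0) := hp.update e le_rfl zero_le_one
      have hz : ∀ e', u ∈ ends e' ∧ e' ≠ e → p e' = 0 := by
        rintro e' ⟨hu, hne⟩
        by_contra h
        exact hne (huniq e' hu h)
      have hends' : ends e = s(u, w) := by rw [hends, Sym2.eq_swap]
      -- the Rao–Blackwell sums and masses at `p` and at `p[e ↦ 0]` agree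
      have hrb : ∀ (x y x' y' : V), x ≠ u → y ≠ u → x' ≠ u → y' ≠ u →
          RBRoot.rbSum p ends s t w (connEvent ends x y) (connEvent ends x' y') =
          RBRoot.rbSum (Function.update p e 0) ends s t w (connEvent ends x y)
            (connEvent ends x' y') := by
        intro x y x' y' hx hy hx' hy'
        refine RBLeaf.rbSum_prune_leaf ends s t w u p hz hends' huw.symm huw.symm hus.symm hut.symm
          _ _ ?_ ?_
        · intro ω hcl
          simp only [mem_connEvent]
          exact RBLeaf.conn_update_leaf ends u hends' hcl hx hy
        · intro ω hcl
          simp only [mem_connEvent]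
          exact RBLeaf.conn_update_leaf ends u hends' hcl hx' hy'
      obtain ⟨m1, m2, m3, m4, -, -⟩ := RBTwoMarkers.prob_leaf_update_events ends u p hz hends'
        s t b o hus.symm hut.symm hub.symm huo.symm 0 (Or.inl rfl)
      -- the hypothesis is inherited by `p[e ↦ 0]`
      have H' : ∀ e', w ∈ ends e' → Function.update p e 0 e' ≠ 0 →
          ends e' = s(w, s) ∨ ends e' = s(w, t) ∨ ends e' = s(w, b) ∨ ends e' = s(w, o) ∨
            ∃ u, ends e' = s(w, u) ∧ u ≠ s ∧ u ≠ t ∧ u ≠ b ∧ u ≠ o ∧ u ≠ w ∧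
              ∀ e'', u ∈ ends e'' → Function.update p e 0 e'' ≠ 0 → e'' = e' := by
        intro e' he' hpe'
        have hne : e' ≠ e := by
          rintro rfl
          exact hpe' (Function.update_self _ _ _)
        rw [Function.update_of_ne hne] at hpe'
        rcases H e' he' hpe' with h | h | h | h | ⟨u', h1, h2, h3, h4, h5, h6, h7⟩
        · exact Or.inl h
        · exact Or.inr (Or.inl h)
        · exact Or.inr (Or.inr (Or.inl h))
        · exact Or.inr (Or.inr (Or.inr (Or.inl h)))
        · refine Or.inr (Or.inr (Or.inr (Or.inr ⟨u', h1, h2, h3, h4, h5, h6,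
            fun e'' hu'' hp'' => h7 e'' hu'' ?_⟩)))
          intro h0
          apply hp''
          by_cases h'' : e'' = e
          · subst h''; exact Function.update_self _ _ _
          · rw [Function.update_of_ne h'']; exact h0
      have hcard' : (Finset.univ.filter (fun e' => Function.update p e 0 e' ≠ 0)).card ≤ n := by
        have hsub : Finset.univ.filter (fun e' => Function.update p e 0 e' ≠ 0) ⊆
            (Finset.univ.filter (fun e' => p e' ≠ 0)).erase e := by
          intro e' he'
          rw [Finset.mem_filter] at he'
          rw [Finset.mem_erase, Finset.mem_filter]
          have hne : e' ≠ e := by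
            rintro rfl
            exact he'.2 (Function.update_self _ _ _)
          refine ⟨hne, Finset.mem_univ _, ?_⟩
          have := he'.2
          rwa [Function.update_of_ne hne] at this
        have hmem : e ∈ Finset.univ.filter (fun e' => p e' ≠ 0) :=
          Finset.mem_filter.2 ⟨Finset.mem_univ e, hpe⟩
        have h1 := Finset.card_le_card hsub
        rw [Finset.card_erase_of_mem hmem] at h1
        omega
      have key := ih (Function.update p e 0) hp'v H' hcard'
      have goal' : (RBRoot.rbSum p ends s t w (connEvent ends b s) (connEvent ends o t) ≤
          prob p ((connEvent ends s t)ᶜ ∩ connEvent ends b s) *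
            prob p ((connEvent ends s t)ᶜ ∩ connEvent ends o t) / prob p (connEvent ends s t)ᶜ) ∧
          (prob p ((connEvent ends s t)ᶜ ∩ connEvent ends b s) *
            prob p ((connEvent ends s t)ᶜ ∩ connEvent ends o s) / prob p (connEvent ends s t)ᶜ ≤
          RBRoot.rbSum p ends s t w (connEvent ends b s) (connEvent ends o s)) := by
        rw [hrb b s o t hub.symm hus.symm huo.symm hut.symm,
          hrb b s o s hub.symm hus.symm huo.symm hus.symm, ← m1, ← m2, ← m3, ← m4]
        exact key
      exact goal'
    · refine RBcross_and_RBsame_of_nbhd' hp ends o b s t w fun e he hpe => ?_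
      rcases H e he hpe with h | h | h | h | hpd
      · exact Or.inl h
      · exact Or.inr (Or.inl h)
      · exact Or.inr (Or.inr (Or.inl h))
      · exact Or.inr (Or.inr (Or.inr h))
      · exact absurd ⟨e, he, hpe, hpd⟩ hpend

omit [DecidableEq V] [IsStrictOrderedRing R] in
/-- **Pruning one unmarked pendant vertex preserves the row's sums and masses**: for `u ∉ {s, t, b, o, w}`
whose only nonzero-weight edge is `f = {u, v}`, `v ≠ u`, both sides of both forms are the same at
`p` and at `p[f ↦ 0]`. -/
theorem RBcross_and_RBsame_prune_iff {p : E → R} (ends : E → Sym2 V) (o b s t w : V) {f : E}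
    {u v : V} (hends : ends f = s(u, v)) (hvu : v ≠ u) (hus : u ≠ s) (hut : u ≠ t) (hub : u ≠ b)
    (huo : u ≠ o) (huw : u ≠ w) (huniq : ∀ e, u ∈ ends e → p e ≠ 0 → e = f) :
    (RBcross p ends o b s t w ∧ RBsame p ends o b s t w) ↔
      (RBcross (Function.update p f 0) ends o b s t w ∧
        RBsame (Function.update p f 0) ends o b s t w) := by
  have hz : ∀ e', u ∈ ends e' ∧ e' ≠ f → p e' = 0 := by
    rintro e' ⟨hu, hne⟩
    by_contra h
    exact hne (huniq e' hu h)
  have hrb : ∀ (x y x' y' : V), x ≠ u → y ≠ u → x' ≠ u → y' ≠ u →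
      RBRoot.rbSum p ends s t w (connEvent ends x y) (connEvent ends x' y') =
      RBRoot.rbSum (Function.update p f 0) ends s t w (connEvent ends x y) (connEvent ends x' y') := by
    intro x y x' y' hx hy hx' hy'
    refine RBLeaf.rbSum_prune_leaf ends s t w u p hz hends hvu huw.symm hus.symm hut.symm _ _ ?_ ?_
    · intro ω hcl
      simp only [mem_connEvent]
      exact RBLeaf.conn_update_leaf ends u hends hcl hx hy
    · intro ω hcl
      simp only [mem_connEvent]
      exact RBLeaf.conn_update_leaf ends u hends hcl hx' hy'
  obtain ⟨m1, m2, m3, m4, -, -⟩ := RBTwoMarkers.prob_leaf_update_events ends u p hz hends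
    s t b o hus.symm hut.symm hub.symm huo.symm 0 (Or.inl rfl)
  unfold RBcross RBsame Qst
  rw [rbSum_eq_rbRoot, rbSum_eq_rbRoot, rbSum_eq_rbRoot, rbSum_eq_rbRoot,
    hrb b s o t hub.symm hus.symm huo.symm hut.symm, hrb b s o s hub.symm hus.symm huo.symm hus.symm]
  exact Iff.of_eq (by rw [← m1, ← m2, ← m3, ← m4])

omit [DecidableEq V] in
/-- **The typed row at every vertex whose weight vector prunes to the kernel class** (pendant
unmarked trees of any depth, anywhere; parallel edges free). -/
theorem RBcross_and_RBsame_of_prunable {p : E → R} (hp : IsProbVec p) (ends : E → Sym2 V)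
    (o b s t w : V) (hpr : Prunable ends s t b o w p) :
    RBcross p ends o b s t w ∧ RBsame p ends o b s t w := by
  induction hpr with
  | kernel p H => exact RBcross_and_RBsame_of_nbhd' hp ends o b s t w H
  | prune p f u v hends hvu hus hut hub huo huw huniq _ ih =>
    exact (RBcross_and_RBsame_prune_iff ends o b s t w hends hvu hus hut hub huo huw huniq).2
      (ih (hp.update f le_rfl zero_le_one))

end RB

end Summit.Ventures.PercRepro2
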